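import Mathlib.AlgebraicGeometry.Normalization
import Mathlib.AlgebraicGeometry.Morphisms.LocalFlatDescent
import Mathlib.AlgebraicGeometry.Morphisms.Etale
import HarnessLib

/-!
# Étaleness of the finite part of a Stein factorisation is étale-local on the base

Topic: `Literature/AlgebraicGeometry/Resolution`. Bookkeeping for de Jong 1996, 4.12 ("Note that
`Y' → ℙ^{d-1}` is (finite) étale", the named fact `DeJong1996SteinFactorizationEtale` of
`AlterationsFibresConnected.lean`), where `Y' = f.normalization` is Mathlib's relative
normalization of the base in the source (Stacks 035H; the Stein factorisation for `f` proper)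
and `π = f.fromNormalization`. To prove `π` étale it suffices to do so after base change to
étale neighbourhoods of the closed points — this file PROVES that reduction from three Mathlib
theorems: relative normalization commutes with smooth base change (Stacks 03GV,
`Scheme.Hom.normalizationPullback`), étaleness descends along fppf covers
(`DescendsAlong @Etale (@Surjective ⊓ @Flat ⊓ @LocallyOfFinitePresentation)`,
`Morphisms/LocalFlatDescent`), and étaleness is Zariski-local on the target; plus the Jacobson
property (an open containing all closed points is everything).

* `etale_pullback_snd_fromNormalization_iff` — for `g : U → Y` smooth,
  `Y' ×_Y U → U` is étale iff the finite part of the Stein factorisation of `X ×_Y U → U` is;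
* `etale_morphismRestrict_of_etale_pullback_snd` — if `g : U → Y` is étale and the base change
  of `π : Y' → Y` to `U` is étale, then `π` is étale over the open image of `g`;
* `etale_fromNormalization_of_forall_isClosed` — if every closed point of the Jacobson scheme
  `Y` is in the image of an étale `g : U → Y` with `(X ×_Y U → U).fromNormalization` étale, then
  `f.fromNormalization` is étale.

[folklore]; no definitions, no named facts (the open image of `g` is written out as
`⟨Set.range g, g.isOpenMap.isOpen_range⟩`).

## Sources

* The Stacks Project, Tags 03GV, 02VN (fppf descent of étaleness), 035H. [StacksProject]
* A. J. de Jong, *Smoothness, semi-stability and alterations*, Publ. Math. IHÉS 83 (1996), 4.12,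
  p. 68 (the use). [DeJong1996]
-/

noncomputable section

open CategoryTheory CategoryTheory.Limits AlgebraicGeometry TopologicalSpace

namespace Literature.AlgebraicGeometry.Resolution

universe u

/-- **Stacks 03GV, arrow form**: for `g : U → Y` smooth, the base change `Y' ×_Y U → U` of the
finite part `π : Y' → Y` of the Stein factorisation of a quasi-compact quasi-separated
`f : X → Y` is étale iff the finite part of the Stein factorisation of `X ×_Y U → U` is étale
(the two differ by Mathlib's isomorphism `normalizationPullback`).
[cite: StacksProject, Tag 03GV] -/
theorem etale_pullback_snd_fromNormalization_iff {X Y U : Scheme.{u}} (f : X ⟶ Y)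
    [QuasiCompact f] [QuasiSeparated f] (g : U ⟶ Y) [Smooth g] :
    Etale (pullback.snd f.fromNormalization g) ↔ Etale (pullback.snd f g).fromNormalization := by
  rw [← Scheme.Hom.normalizationPullback_snd f g]
  exact (MorphismProperty.cancel_left_of_respectsIso @Etale _ _).symm

/-- **fppf descent of étaleness over the image of an étale neighbourhood**: if `g : U → Y` is
étale and the base change `Y' ×_Y U → U` of `π : Y' → Y` is étale, then `π` is étale over the
(open) image of `g` — `U → g(U)` is a surjective, flat, locally finitely presented cover and
`Etale` descends along such (Mathlib `DescendsAlong @Etale …`). [cite: StacksProject, Tag 02VN] -/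
theorem etale_morphismRestrict_of_etale_pullback_snd {Y' Y U : Scheme.{u}} (π : Y' ⟶ Y)
    (g : U ⟶ Y) [Etale g] (h : Etale (pullback.snd π g)) :
    Etale (π ∣_ (⟨Set.range g, g.isOpenMap.isOpen_range⟩ : Y.Opens)) := by
  set V : Y.Opens := ⟨Set.range g, g.isOpenMap.isOpen_range⟩ with hVdef
  have hVr : Set.range g ⊆ Set.range V.ι := by
    rw [Scheme.Opens.range_ι]
    exact subset_of_eq rfl
  let g' : U ⟶ V := IsOpenImmersion.lift V.ι g hVr
  have hg' : g' ≫ V.ι = g := IsOpenImmersion.lift_fac _ _ _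
  -- `g'` is étale and surjective
  haveI : Etale g' := by
    have : Etale (g' ≫ V.ι) := by rw [hg']; infer_instance
    exact Etale.of_comp g' V.ι
  haveI : Surjective g' := ⟨fun v => by
    obtain ⟨u, hu⟩ := (show v.1 ∈ Set.range g from v.2)
    refine ⟨u, V.ι.isOpenEmbedding.injective ?_⟩
    rw [← Scheme.Hom.comp_apply, hg', hu]
    rfl⟩
  -- the base change of `π ∣_ V` along `g'` is the base change of `π` along `g`
  have hr : Set.range (pullback.fst π g) ⊆ Set.range (π ⁻¹ᵁ V).ι := by
    rintro _ ⟨a, rfl⟩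
    rw [Scheme.Opens.range_ι]
    change π (pullback.fst π g a) ∈ V
    rw [← Scheme.Hom.comp_apply, pullback.condition, Scheme.Hom.comp_apply]
    exact ⟨_, rfl⟩
  let m := IsOpenImmersion.lift (π ⁻¹ᵁ V).ι (pullback.fst π g) hr
  have hm : m ≫ (π ⁻¹ᵁ V).ι = pullback.fst π g := IsOpenImmersion.lift_fac _ _ _
  have big : IsPullback (m ≫ (π ⁻¹ᵁ V).ι) (pullback.snd π g) π (g' ≫ V.ι) := by
    rw [hm, hg']
    exact IsPullback.of_hasPullback π g
  have w : m ≫ (π ∣_ V) = pullback.snd π g ≫ g' := by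
    rw [← cancel_mono V.ι, Category.assoc, Category.assoc, morphismRestrict_ι, hg',
      ← Category.assoc, hm, pullback.condition]
  have sq : IsPullback m (pullback.snd π g) (π ∣_ V) g' :=
    IsPullback.of_right big w (isPullback_morphismRestrict π V).flip
  -- descend
  have hQ : (@Surjective ⊓ @Flat ⊓ @LocallyOfFinitePresentation : MorphismProperty Scheme) g' :=
    ⟨⟨‹_›, inferInstance⟩, inferInstance⟩
  exact MorphismProperty.of_isPullback_of_descendsAlong (P := @Etale)
    (Q := @Surjective ⊓ @Flat ⊓ @LocallyOfFinitePresentation) sq.flip hQ h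

/-- **Étaleness of `Y' → Y` is étale-local at the closed points**: let `f : X → Y` be
quasi-compact and quasi-separated with `Y` Jacobson (e.g. locally of finite type over a field).
If every closed point `y ∈ Y` lies in the image of some étale `g : U → Y` for which the finite
part of the Stein factorisation of `X ×_Y U → U` is étale, then `π = f.fromNormalization` is
étale: over the image of each `g` by 03GV and fppf descent
(`etale_morphismRestrict_of_etale_pullback_snd`), and these opens cover `Y` because an open
containing all closed points of a Jacobson space is everything. [folklore] -/
theorem etale_fromNormalization_of_forall_isClosed {X Y : Scheme.{u}} (f : X ⟶ Y)
    [QuasiCompact f] [QuasiSeparated f] [JacobsonSpace Y]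
    (h : ∀ y : Y, IsClosed ({y} : Set Y) → ∃ (U : Scheme.{u}) (g : U ⟶ Y) (_ : Etale g),
      y ∈ Set.range g ∧ Etale (pullback.snd f g).fromNormalization) :
    Etale f.fromNormalization := by
  choose U g hg hy hE using h
  let V : {y : Y // IsClosed ({y} : Set Y)} → Y.Opens := fun y =>
    ⟨Set.range (g y.1 y.2), by
      haveI := hg y.1 y.2
      exact (g y.1 y.2).isOpenMap.isOpen_range⟩
  have hV : iSup V = ⊤ := by
    rw [eq_top_iff]
    rintro z -
    -- the complement of `⋃ V` is closed and contains no closed point, hence is empty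
    by_contra hz
    set Z : Set Y := ((iSup V : Y.Opens) : Set Y)ᶜ with hZ
    have hZc : IsClosed Z := (iSup V).isOpen.isClosed_compl
    have hZne : Z.Nonempty := ⟨z, hz⟩
    obtain ⟨y, hyZ, hyc⟩ := nonempty_inter_closedPoints hZne hZc.isLocallyClosed
    apply hyZ
    rw [SetLike.mem_coe, Opens.mem_iSup]
    exact ⟨⟨y, hyc⟩, hy y hyc⟩
  refine IsZariskiLocalAtTarget.of_iSup_eq_top (P := @Etale) V hV fun y => ?_
  haveI := hg y.1 y.2
  exact etale_morphismRestrict_of_etale_pullback_snd f.fromNormalization (g y.1 y.2)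
    ((etale_pullback_snd_fromNormalization_iff f (g y.1 y.2)).mpr (hE y.1 y.2))

end Literature.AlgebraicGeometry.Resolution

end
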